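import Literature.NumberTheory.GaloisRepresentations.TeichmullerLiftMonomial
import Literature.NumberTheory.GaloisRepresentations.ResiduallyReducibleOfStableLine
import HarnessLib

/-!
# The local shape of the Teichmüller lift `Ind χ`: a sum of two characters wherever `ρ̄` is
# reducible (Allen 2014, Lemma 87)

Theorems only (no definition of a notion, no named fact; D-0026), written by the seat of the
named fact `Literature.NumberTheory.Automorphic.Allen2014_modularity_nearlyOrdinaryDihedral_Q`
(P. B. Allen, *Modularity of nearly ordinary 2-adic residually dihedral Galois representations*,
Compositio Math. 150 (2014) = arXiv:1301.1113), continuing `TeichmullerLiftMonomial` (the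
Teichmüller/Artin lift `ρ₁ = Ind χ` of a residual representation `ρ̄ = Ind χ̄` of dihedral type)
with the NEXT step of the proof of Lemma 87 (OrdinaryLift), arXiv:1301.1113 pp. 69–70:

> "Note that the reducibility of `ρ̄|_{G_v}` together with the assumption that `ρ̄` is dihedral
> implies that `ρ̄|_{G_v}` is split or `χ̄_v = χ̄'_v` and `p = 2`. […] we have
> `ρ₁|_{G_v} ≅ (χ'_v 0 ; 0 χ_v)` for `χ'_v` and `χ_v` as above"

(where `ρ̄|_{G_v} ≅ (χ̄'_v ∗ ; 0 χ̄_v)`, p. 69, and `χ_v` lifts `χ̄_v`).  In the tree's matrix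
language: let `ρ₀ : G → GL₂(ℤ̄_p)` be MONOMIAL (every reduction `ρ₀(g) mod 𝔪` diagonal or
antidiagonal) with entries `0` or `n`-th roots of unity, `p ∤ n` — the output of the Teichmüller
lift of `TeichmullerLiftMonomial` — and let `f : H → G` be a homomorphism (a decomposition group)
such that the reduction `ρ̄ ∘ f` has an upper-triangular form `Q (ρ̄ ∘ f) Q⁻¹` with diagonal
characters `(ā, b̄)`.  Then `ρ₀ ∘ f` is conjugate IN `GL₂(ℚ̄_p)` to the diagonal representation
`diag(χ₁, χ₂)` with `χ₁, χ₂ : H → ℤ̄_p` of finite order (dividing `2n`) and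
`χ₁ ≡ ā`, `χ₂ ≡ b̄ (mod 𝔪)` (`exists_conjGL_diagonal_comp_of_monomial`).  The proof is the one
implicit in Allen's two sentences: if `ρ̄(f H)` is diagonal in the monomial frame, `ρ₀ ∘ f` is
already diagonal (Teichmüller lift entry by entry); otherwise some `ρ̄(f h₀)` is antidiagonal, a
common eigenvector of `ρ̄ ∘ f` has both coordinates non-zero, so the two diagonal characters of
`ρ̄` agree on the diagonal part of `f H` ("`χ̄_v = χ̄'_v`"), hence — Teichmüller representatives
being unique — `ρ₀` is SCALAR there, and `ρ₀(f H)` is generated by scalars and one antidiagonal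
matrix `(0 u ; w 0)`, diagonalised by `(u u ; s -s)`, `s² = u w` (the frame has determinant
`-2us`, which is why the splitting is rational but, at `p = 2`, not integral: the reduction may be
non-split).  The identification of the residual diagonal characters is by comparison of
characteristic polynomials and the remark that a group is not the union of two proper subgroups.

## Main results (all proved)

* `forall_eq_or_forall_eq_of_forall_apply_eq_or` — a character agreeing pointwise with one of two
  characters agrees globally with one of them.
* `eq_and_eq_or_eq_and_eq_of_mul_X_sub_C_eq` — `(X - a)(X - b) = (X - c)(X - d)` over a field
  forces `{a, b} = {c, d}`.
* `exists_conjGL_diagonal_comp_of_monomial` — the theorem above (any group `G`, any `f : H → G`).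
* `exists_teichmullerLift_of_isDihedralType_shape`,
  `FramedGaloisRep.exists_artinLift_of_isDihedralType_diagonal` — the Teichmüller/Artin lift of
  `TeichmullerLiftMonomial` with its monomial shape exported, and, for `ρ : Γ_K → GL₂(ℚ̄_p)` over
  a number field with residual representation `τ` of irreducible dihedral type: the continuous
  Artin lift `ρ₁` of `τ` is, on the decomposition group at ANY finite place `v` where `τ` admits a
  triangular form `(ā ∗ ; 0 b̄)`, conjugate to `diag(χ₁, χ₂)` with `χ₁, χ₂ : Γ_{K_v} → ℤ̄_p`
  continuous of finite order, `χ̄₁ = ā`, `χ̄₂ = b̄`.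
* `FramedGaloisRep.exists_artinLift_residualRep_diagonal_of_isSolvable_two`,
  `FramedGaloisRep.exists_artinLift_residualRep_diagonal_of_isOrdinaryOfWeightAt_two` — at
  `p = 2`, straight from hypotheses (4) (`ρ̄` absolutely irreducible with solvable image) and (2)
  (`ρ` nearly ordinary at `v`, so `ρ̄|_{Γ_{K_v}}` is reducible, `ResiduallyReducibleOfStableLine`)
  of Allen's Introduction Theorem: the Artin lift `ρ₁` of `ρ̄ = ρ.residualRep` satisfies
  `ρ₁|_{Γ_{K_v}} ≅ χ'_v ⊕ χ_v` with `χ_v` lifting the character `χ̄_v` of a triangular form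
  `ρ̄|_{Γ_{K_v}} ≅ (χ̄'_v ∗ ; 0 χ̄_v)` — Allen's display on p. 70.

## References

* P. B. Allen, Compositio Math. 150 (2014) 1235–1346, Lemma 87 and the paragraph before it
  (= arXiv:1301.1113, §5.1.1, pp. 69–70). [Allen2014]
* J.-P. Serre, *Local Fields*, GTM 67, Ch. II §4, Prop. 8 (Teichmüller representatives).
  [SerreLocalFields1979]
-/

noncomputable section

open scoped MatrixGroups NumberField
open Matrix IsLocalRing Polynomial IsDedekindDomain

namespace Literature.NumberTheory.GaloisRepresentations

variable {p : ℕ} [Fact p.Prime]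

/-! ### Two elementary lemmas -/

section Elementary

/-- If a character of a group agrees at every element with one of two given characters, it
agrees everywhere with one of them (a group is not the union of two proper subgroups).
[folklore] -/
theorem forall_eq_or_forall_eq_of_forall_apply_eq_or {H : Type*} [Group H] {k : Type*} [Field k]
    (a c d : H →* k) (h : ∀ x, a x = c x ∨ a x = d x) :
    (∀ x, a x = c x) ∨ (∀ x, a x = d x) := by
  by_contra hcon
  push Not at hcon
  obtain ⟨⟨x, hx⟩, ⟨y, hy⟩⟩ := hcon
  have hne : ∀ (e : H →* k) (z : H), e z ≠ 0 := fun e z h0 => by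
    have h1 : e (z * z⁻¹) = 1 := by rw [mul_inv_cancel, map_one]
    rw [map_mul, h0, zero_mul] at h1
    exact zero_ne_one h1
  have hxd : a x = d x := (h x).resolve_left hx
  have hyc : a y = c y := (h y).resolve_right hy
  rcases h (x * y) with hxy | hxy
  · rw [map_mul, map_mul, hyc] at hxy
    exact hx (mul_right_cancel₀ (hne c y) hxy)
  · rw [map_mul, map_mul, hxd] at hxy
    exact hy (mul_left_cancel₀ (hne d x) hxy)

/-- `(X - a)(X - b) = (X - c)(X - d)` over a field forces `{a, b} = {c, d}`. [folklore] -/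
theorem eq_and_eq_or_eq_and_eq_of_mul_X_sub_C_eq {k : Type*} [Field k] {a b c d : k}
    (h : (X - C a) * (X - C b) = (X - C c) * (X - C d)) :
    (a = c ∧ b = d) ∨ (a = d ∧ b = c) := by
  have ev : ∀ x : k, (x - a) * (x - b) = (x - c) * (x - d) := fun x => by
    have := congrArg (Polynomial.eval x) h
    simpa only [eval_mul, eval_sub, eval_X, eval_C] using this
  have ha : a = c ∨ a = d := by
    have h0 := ev a
    rw [sub_self, zero_mul, eq_comm, mul_eq_zero, sub_eq_zero, sub_eq_zero] at h0
    exact h0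
  have hb : b = c ∨ b = d := by
    have h0 := ev b
    rw [sub_self, mul_zero, eq_comm, mul_eq_zero, sub_eq_zero, sub_eq_zero] at h0
    exact h0
  have hc : c = a ∨ c = b := by
    have h0 := ev c
    rw [sub_self, zero_mul, mul_eq_zero, sub_eq_zero, sub_eq_zero] at h0
    exact h0
  have hd : d = a ∨ d = b := by
    have h0 := ev d
    rw [sub_self, mul_zero, mul_eq_zero, sub_eq_zero, sub_eq_zero] at h0
    exact h0
  rcases ha with h1 | h1
  · left
    refine ⟨h1, ?_⟩
    rcases hd with h2 | h2
    · rcases hb with h3 | h3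
      · rw [h3, ← h1, ← h2]
      · exact h3
    · exact h2.symm
  · right
    refine ⟨h1, ?_⟩
    rcases hc with h2 | h2
    · rcases hb with h3 | h3
      · exact h3
      · rw [h3, ← h1, ← h2]
    · exact h2.symm

/-- A root of unity of `ℚ̄_p` lies in `ℤ̄_p`. [folklore] -/
theorem mem_padicAlgClIntegers_of_pow_eq_one {x : PadicAlgCl p} {m : ℕ} (hm : m ≠ 0)
    (hx : x ^ m = 1) : x ∈ padicAlgClIntegers p := by
  rw [padicAlgCl_mem_valuationSubring_iff, PadicAlgCl.norm_eq_one_of_pow_eq_one hm hx]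

/-- A root of unity of `ℤ̄_p` has non-zero residue. [folklore] -/
theorem residue_ne_zero_of_coe_pow_eq_one {n : ℕ} (hn : n ≠ 0) {x : padicAlgClIntegers p}
    (hx : (x : PadicAlgCl p) ^ n = 1) : residue (padicAlgClIntegers p) x ≠ 0 := by
  rw [Ne, residue_eq_zero_iff, mem_maximalIdeal_padicAlgClIntegers_iff_norm_lt_one,
    PadicAlgCl.norm_eq_one_of_pow_eq_one hn hx]
  exact lt_irrefl 1

end Elementary

/-! ### The local shape of a monomial Teichmüller lift -/

section LocalShape

variable {G H : Type*} [Group G] [Group H]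

/-- **`Ind χ` is a sum of two characters on every subgroup where `Ind χ̄` is reducible** (Allen
2014, Lemma 87 and the paragraph before it: "the reducibility of `ρ̄|_{G_v}` together with the
assumption that `ρ̄` is dihedral implies that `ρ̄|_{G_v}` is split or `χ̄_v = χ̄'_v` and `p = 2`
… we have `ρ₁|_{G_v} ≅ (χ'_v 0 ; 0 χ_v)`").  Let `ρ₀ : G → GL₂(ℤ̄_p)` have every reduction
`ρ₀(g) mod 𝔪` diagonal or antidiagonal and every entry `0` or an `n`-th root of unity, `p ∤ n`
(the Teichmüller lift of a monomial representation, `exists_teichmullerLift_of_isDihedralType_shape`),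
and let `f : H → G` be a homomorphism such that the reduction `ρ̄ ∘ f` has the upper-triangular
form `Q (ρ̄ ∘ f) Q⁻¹ = (ā ∗ ; 0 b̄)`.  Then there are `P ∈ GL₂(ℚ̄_p)` and `χ₁, χ₂ : H → ℤ̄_p`
multiplicative with `P⁻¹ ρ₀(f h) P = diag(χ₁ h, χ₂ h)`, `χᵢ(h)^{2n} = 1`, and
`χ₁ ≡ ā`, `χ₂ ≡ b̄ (mod 𝔪)`.
[cite: Allen2014, Lemma 87 and the preceding paragraph (arXiv:1301.1113, §5.1.1, pp. 69–70)] -/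
theorem exists_conjGL_diagonal_comp_of_monomial {n : ℕ} (hn0 : 0 < n) (hn : ¬ p ∣ n)
    (ρ₀ : G →* GL (Fin 2) (padicAlgClIntegers p))
    (hroots : ∀ g i j, (ρ₀ g).val i j = 0 ∨ ((ρ₀ g).val i j : PadicAlgCl p) ^ n = 1)
    (hshape : ∀ g, GL2.IsDg (integralReduction (RingHom.id _) ρ₀ g).val ∨
      GL2.IsAd (integralReduction (RingHom.id _) ρ₀ g).val)
    (f : H →* G) (Q : GL (Fin 2) (padicAlgClResidueField p))
    (hQ : ∀ h, (conjGL Q ((integralReduction (RingHom.id _) ρ₀).comp f) h).val 1 0 = 0) :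
    ∃ (P : GL (Fin 2) (PadicAlgCl p)) (χ₁ χ₂ : H →* padicAlgClIntegers p),
      (∀ h, (P⁻¹ * Matrix.GeneralLinearGroup.map (padicAlgClIntegers p).subtype (ρ₀ (f h)) * P).val =
        Matrix.diagonal ![(χ₁ h : PadicAlgCl p), (χ₂ h : PadicAlgCl p)]) ∧
      (∀ h, (χ₁ h : PadicAlgCl p) ^ (2 * n) = 1 ∧ (χ₂ h : PadicAlgCl p) ^ (2 * n) = 1) ∧
      ∀ h, residue (padicAlgClIntegers p) (χ₁ h) =
          (conjGL Q ((integralReduction (RingHom.id _) ρ₀).comp f) h).val 0 0 ∧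
        residue (padicAlgClIntegers p) (χ₂ h) =
          (conjGL Q ((integralReduction (RingHom.id _) ρ₀).comp f) h).val 1 1 := by
  classical
  /- (0) Dictionary between the entries of `ρ₀ g`, of its reduction, and of its image in
  `GL₂(ℚ̄_p)`. -/
  have hred : ∀ g (i j : Fin 2), (integralReduction (RingHom.id _) ρ₀ g).val i j =
      residue (padicAlgClIntegers p) ((ρ₀ g).val i j) := fun g i j => by
    rw [integralReduction_apply_coe, RingHom.id_apply]
  have hz : ∀ g (i j : Fin 2),
      (integralReduction (RingHom.id _) ρ₀ g).val i j = 0 ↔ (ρ₀ g).val i j = 0 := by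
    intro g i j
    rw [hred]
    constructor
    · intro h
      rcases hroots g i j with h0 | h1
      · exact h0
      · exact absurd h (residue_ne_zero_of_coe_pow_eq_one hn0.ne' h1)
    · intro h
      rw [h, map_zero]
  have hunit : ∀ g (i j : Fin 2), (ρ₀ g).val i j ≠ 0 →
      ((ρ₀ g).val i j : PadicAlgCl p) ^ n = 1 := fun g i j h => (hroots g i j).resolve_left h
  have hdetk : ∀ g, (integralReduction (RingHom.id _) ρ₀ g).val 0 0 *
      (integralReduction (RingHom.id _) ρ₀ g).val 1 1 -
      (integralReduction (RingHom.id _) ρ₀ g).val 0 1 *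
      (integralReduction (RingHom.id _) ρ₀ g).val 1 0 ≠ 0 := fun g => by
    have h := (integralReduction (RingHom.id _) ρ₀ g).isUnit.map Matrix.detMonoidHom
    rw [Matrix.coe_detMonoidHom, Matrix.det_fin_two] at h
    exact h.ne_zero
  have hDgO : ∀ g, GL2.IsDg (integralReduction (RingHom.id _) ρ₀ g).val →
      (ρ₀ g).val 0 1 = 0 ∧ (ρ₀ g).val 1 0 = 0 ∧ (ρ₀ g).val 0 0 ≠ 0 ∧ (ρ₀ g).val 1 1 ≠ 0 := by
    intro g hg
    refine ⟨(hz g 0 1).1 hg.1, (hz g 1 0).1 hg.2, fun h0 => ?_, fun h0 => ?_⟩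
    · apply hdetk g
      rw [(hz g 0 0).2 h0, hg.1]
      ring
    · apply hdetk g
      rw [(hz g 1 1).2 h0, hg.2]
      ring
  have hAdO : ∀ g, GL2.IsAd (integralReduction (RingHom.id _) ρ₀ g).val →
      (ρ₀ g).val 0 0 = 0 ∧ (ρ₀ g).val 1 1 = 0 ∧ (ρ₀ g).val 0 1 ≠ 0 ∧ (ρ₀ g).val 1 0 ≠ 0 := by
    intro g hg
    refine ⟨(hz g 0 0).1 hg.1, (hz g 1 1).1 hg.2, fun h0 => ?_, fun h0 => ?_⟩
    · apply hdetk g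
      rw [(hz g 0 1).2 h0, hg.1]
      ring
    · apply hdetk g
      rw [(hz g 1 0).2 h0, hg.2]
      ring
  have hF : ∀ g (i j : Fin 2),
      (Matrix.GeneralLinearGroup.map (padicAlgClIntegers p).subtype (ρ₀ g)).val i j =
        ((ρ₀ g).val i j : PadicAlgCl p) := fun g i j => rfl
  /- (1) every `ρ₀ g` has order dividing `2n` in `GL₂(ℚ̄_p)` -/
  have hpow : ∀ g,
      Matrix.GeneralLinearGroup.map (padicAlgClIntegers p).subtype (ρ₀ g) ^ (2 * n) = 1 := by
    intro g
    apply Units.ext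
    rw [Units.val_pow_eq_pow_val, Units.val_one, pow_mul]
    rcases hshape g with hg | hg
    · obtain ⟨h01, h10, h00, h11⟩ := hDgO g hg
      have ha := hunit g 0 0 h00
      have hd := hunit g 1 1 h11
      have hsq : (Matrix.GeneralLinearGroup.map (padicAlgClIntegers p).subtype (ρ₀ g)).val ^ 2 =
          Matrix.diagonal ![((ρ₀ g).val 0 0 : PadicAlgCl p) * ((ρ₀ g).val 0 0 : PadicAlgCl p),
            ((ρ₀ g).val 1 1 : PadicAlgCl p) * ((ρ₀ g).val 1 1 : PadicAlgCl p)] := by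
        ext i j
        fin_cases i <;> fin_cases j <;>
          simp [pow_two, Matrix.mul_apply, Fin.sum_univ_two, h01, h10, Matrix.diagonal]
      rw [hsq, Matrix.diagonal_pow]
      ext i j
      fin_cases i <;> fin_cases j <;> simp [Matrix.diagonal, mul_pow, ha, hd]
    · obtain ⟨h00, h11, h01, h10⟩ := hAdO g hg
      have hb := hunit g 0 1 h01
      have hc := hunit g 1 0 h10
      have hsq : (Matrix.GeneralLinearGroup.map (padicAlgClIntegers p).subtype (ρ₀ g)).val ^ 2 =
          Matrix.diagonal ![((ρ₀ g).val 0 1 : PadicAlgCl p) * ((ρ₀ g).val 1 0 : PadicAlgCl p),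
            ((ρ₀ g).val 0 1 : PadicAlgCl p) * ((ρ₀ g).val 1 0 : PadicAlgCl p)] := by
        ext i j
        fin_cases i <;> fin_cases j <;>
          simp [pow_two, Matrix.mul_apply, Fin.sum_univ_two, h00, h11, Matrix.diagonal,
            mul_comm]
      rw [hsq, Matrix.diagonal_pow]
      ext i j
      fin_cases i <;> fin_cases j <;> simp [Matrix.diagonal, mul_pow, hb, hc]
  /- (2) A frame `P ∈ GL₂(ℚ̄_p)` in which `ρ₀ ∘ f` is diagonal. -/
  obtain ⟨P, hP⟩ : ∃ P : GL (Fin 2) (PadicAlgCl p), ∀ h,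
      GL2.IsDg (P⁻¹ * Matrix.GeneralLinearGroup.map (padicAlgClIntegers p).subtype (ρ₀ (f h)) *
        P).val := by
    by_cases hall : ∀ h, GL2.IsDg (integralReduction (RingHom.id _) ρ₀ (f h)).val
    · -- the split case: `ρ₀ ∘ f` is already diagonal
      refine ⟨1, fun h => ?_⟩
      obtain ⟨h01, h10, -, -⟩ := hDgO _ (hall h)
      rw [inv_one, one_mul, mul_one]
      exact ⟨by simp [hF, h01], by simp [hF, h10]⟩
    · -- the non-split case: some `ρ̄(f h₀)` is antidiagonal
      push Not at hall
      obtain ⟨h₀, hh₀⟩ := hall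
      have had₀ : GL2.IsAd (integralReduction (RingHom.id _) ρ₀ (f h₀)).val :=
        (hshape (f h₀)).resolve_left hh₀
      have hmv : ∀ (M : Matrix (Fin 2) (Fin 2) (padicAlgClResidueField p))
          (w : Fin 2 → padicAlgClResidueField p) (i : Fin 2),
          (M *ᵥ w) i = M i 0 * w 0 + M i 1 * w 1 := fun M w i => by
        simp [Matrix.mulVec, dotProduct, Fin.sum_univ_two]
      -- a common eigenvector `v` of `ρ̄ ∘ f`; both its coordinates are non-zero
      obtain ⟨v, hv0, key⟩ := HasCommonEigenvector.of_conjGL (P := Q)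
        (hasCommonEigenvector_of_apply_one_zero_eq_zero hQ)
      obtain ⟨a₀, ha₀⟩ := key h₀
      have e₀ : (integralReduction (RingHom.id _) ρ₀ (f h₀)).val 0 1 * v 1 = a₀ * v 0 := by
        have t := congr_fun ha₀ 0
        change ((integralReduction (RingHom.id _) ρ₀ (f h₀)).val *ᵥ v) 0 = (a₀ • v) 0 at t
        rw [hmv, Pi.smul_apply, smul_eq_mul, had₀.1, zero_mul, zero_add] at t
        exact t
      have e₁ : (integralReduction (RingHom.id _) ρ₀ (f h₀)).val 1 0 * v 0 = a₀ * v 1 := by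
        have t := congr_fun ha₀ 1
        change ((integralReduction (RingHom.id _) ρ₀ (f h₀)).val *ᵥ v) 1 = (a₀ • v) 1 at t
        rw [hmv, Pi.smul_apply, smul_eq_mul, had₀.2, zero_mul, add_zero] at t
        exact t
      have hu₀k : (integralReduction (RingHom.id _) ρ₀ (f h₀)).val 0 1 ≠ 0 := fun h0 => by
        apply hdetk (f h₀)
        rw [had₀.1, h0]
        ring
      have hw₀k : (integralReduction (RingHom.id _) ρ₀ (f h₀)).val 1 0 ≠ 0 := fun h0 => by
        apply hdetk (f h₀)
        rw [had₀.2, h0]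
        ring
      have hv₀ : v 0 ≠ 0 := fun h0 => by
        apply hv0
        have h1 : v 1 = 0 := by
          rw [h0, mul_zero] at e₀
          exact (mul_eq_zero.mp e₀).resolve_left hu₀k
        ext i
        fin_cases i
        · exact h0
        · exact h1
      have hv₁ : v 1 ≠ 0 := fun h1 => by
        apply hv0
        have h0 : v 0 = 0 := by
          rw [h1, mul_zero] at e₁
          exact (mul_eq_zero.mp e₁).resolve_left hw₀k
        ext i
        fin_cases i
        · exact h0
        · exact h1
      -- "`χ̄_v = χ̄'_v`": on the diagonal part of `f H` the two residual characters agree …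
      have hab : ∀ h, GL2.IsDg (integralReduction (RingHom.id _) ρ₀ (f h)).val →
          (integralReduction (RingHom.id _) ρ₀ (f h)).val 0 0 =
            (integralReduction (RingHom.id _) ρ₀ (f h)).val 1 1 := by
        intro h hdg
        obtain ⟨μ, hμ⟩ := key h
        have t0 := congr_fun hμ 0
        have t1 := congr_fun hμ 1
        change ((integralReduction (RingHom.id _) ρ₀ (f h)).val *ᵥ v) 0 = (μ • v) 0 at t0
        change ((integralReduction (RingHom.id _) ρ₀ (f h)).val *ᵥ v) 1 = (μ • v) 1 at t1
        rw [hmv, Pi.smul_apply, smul_eq_mul, hdg.1, zero_mul, add_zero] at t0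
        rw [hmv, Pi.smul_apply, smul_eq_mul, hdg.2, zero_mul, zero_add] at t1
        rw [mul_right_cancel₀ hv₀ t0, mul_right_cancel₀ hv₁ t1]
      -- … so `ρ₀` is scalar there (uniqueness of Teichmüller representatives)
      have hAB : ∀ h, GL2.IsDg (integralReduction (RingHom.id _) ρ₀ (f h)).val →
          (ρ₀ (f h)).val 0 0 = (ρ₀ (f h)).val 1 1 := by
        intro h hdg
        obtain ⟨-, -, h00, h11⟩ := hDgO _ hdg
        refine teichmuller_unique hn0 hn (hunit _ _ _ h00) (hunit _ _ _ h11) ?_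
        rw [← hred, ← hred]
        exact hab h hdg
      have hscalar : ∀ h, GL2.IsDg (integralReduction (RingHom.id _) ρ₀ (f h)).val →
          (Matrix.GeneralLinearGroup.map (padicAlgClIntegers p).subtype (ρ₀ (f h))).val =
            ((ρ₀ (f h)).val 0 0 : PadicAlgCl p) • (1 : Matrix (Fin 2) (Fin 2) (PadicAlgCl p)) := by
        intro h hdg
        obtain ⟨h01, h10, -, -⟩ := hDgO _ hdg
        have e := hAB h hdg
        ext i j
        fin_cases i <;> fin_cases j <;> simp [hF, h01, h10, e]
      -- antidiagonal elements of `f H` differ from `f h₀` by a diagonal, hence scalar, element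
      have hdg' : ∀ h, GL2.IsAd (integralReduction (RingHom.id _) ρ₀ (f h)).val →
          GL2.IsDg (integralReduction (RingHom.id _) ρ₀ (f (h * h₀⁻¹))).val := by
        intro h had
        rcases hshape (f (h * h₀⁻¹)) with hd | hd
        · exact hd
        · exfalso
          have hmul : (integralReduction (RingHom.id _) ρ₀ (f h)).val =
              (integralReduction (RingHom.id _) ρ₀ (f (h * h₀⁻¹))).val *
                (integralReduction (RingHom.id _) ρ₀ (f h₀)).val := by
            rw [← Units.val_mul, ← map_mul, ← map_mul, inv_mul_cancel_right]
          have h01 : (integralReduction (RingHom.id _) ρ₀ (f h)).val 0 1 = 0 := by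
            rw [hmul, Matrix.mul_apply, Fin.sum_univ_two, hd.1, had₀.2, zero_mul, mul_zero,
              add_zero]
          have h10 : (integralReduction (RingHom.id _) ρ₀ (f h)).val 1 0 = 0 := by
            rw [hmul, Matrix.mul_apply, Fin.sum_univ_two, had₀.1, hd.2, mul_zero, zero_mul,
              add_zero]
          apply hdetk (f h)
          rw [had.1, h01, h10]
          ring
      have hprop : ∀ h, GL2.IsAd (integralReduction (RingHom.id _) ρ₀ (f h)).val →
          (Matrix.GeneralLinearGroup.map (padicAlgClIntegers p).subtype (ρ₀ (f h))).val =
            ((ρ₀ (f (h * h₀⁻¹))).val 0 0 : PadicAlgCl p) •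
              (Matrix.GeneralLinearGroup.map (padicAlgClIntegers p).subtype (ρ₀ (f h₀))).val := by
        intro h had
        have e : Matrix.GeneralLinearGroup.map (padicAlgClIntegers p).subtype (ρ₀ (f h)) =
            Matrix.GeneralLinearGroup.map (padicAlgClIntegers p).subtype (ρ₀ (f (h * h₀⁻¹))) *
              Matrix.GeneralLinearGroup.map (padicAlgClIntegers p).subtype (ρ₀ (f h₀)) := by
          rw [← map_mul, ← map_mul, ← map_mul, inv_mul_cancel_right]
        rw [e, Units.val_mul, hscalar _ (hdg' h had), smul_one_mul]
      -- the antidiagonal generator `ρ₀(f h₀) = (0 u ; w 0)` and the frame `(u u ; s -s)`, `s² = uw`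
      obtain ⟨h00₀, h11₀, h01₀, h10₀⟩ := hAdO _ had₀
      have hu : ((ρ₀ (f h₀)).val 0 1 : PadicAlgCl p) ^ n = 1 := hunit _ _ _ h01₀
      have hw : ((ρ₀ (f h₀)).val 1 0 : PadicAlgCl p) ^ n = 1 := hunit _ _ _ h10₀
      have hu0 : ((ρ₀ (f h₀)).val 0 1 : PadicAlgCl p) ≠ 0 := fun h0 => by
        rw [h0, zero_pow hn0.ne'] at hu
        exact zero_ne_one hu
      obtain ⟨s, hs⟩ := IsAlgClosed.exists_eq_mul_self
        (((ρ₀ (f h₀)).val 0 1 : PadicAlgCl p) * ((ρ₀ (f h₀)).val 1 0 : PadicAlgCl p))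
      have hs0 : s ≠ 0 := fun h0 => by
        rw [h0, mul_zero, mul_eq_zero] at hs
        rcases hs with h | h
        · exact hu0 h
        · rw [h, zero_pow hn0.ne'] at hw
          exact zero_ne_one hw
      have hs' : ((ρ₀ (f h₀)).val 1 0 : PadicAlgCl p) * ((ρ₀ (f h₀)).val 0 1 : PadicAlgCl p) =
          s * s := by rw [mul_comm]; exact hs
      have hPdet : (!![((ρ₀ (f h₀)).val 0 1 : PadicAlgCl p), ((ρ₀ (f h₀)).val 0 1 : PadicAlgCl p);
          s, -s]).det ≠ 0 := by
        rw [Matrix.det_fin_two_of]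
        have e : ((ρ₀ (f h₀)).val 0 1 : PadicAlgCl p) * -s -
            ((ρ₀ (f h₀)).val 0 1 : PadicAlgCl p) * s =
            -(2 * (((ρ₀ (f h₀)).val 0 1 : PadicAlgCl p) * s)) := by ring
        rw [e, neg_ne_zero]
        exact mul_ne_zero two_ne_zero (mul_ne_zero hu0 hs0)
      refine ⟨Matrix.GeneralLinearGroup.mkOfDetNeZero _ hPdet, fun h => ?_⟩
      set P : GL (Fin 2) (PadicAlgCl p) := Matrix.GeneralLinearGroup.mkOfDetNeZero _ hPdet
        with hPdef
      have hPval : P.val = !![((ρ₀ (f h₀)).val 0 1 : PadicAlgCl p),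
          ((ρ₀ (f h₀)).val 0 1 : PadicAlgCl p); s, -s] := rfl
      have hkey : (Matrix.GeneralLinearGroup.map (padicAlgClIntegers p).subtype (ρ₀ (f h₀))).val *
          P.val = P.val * Matrix.diagonal ![s, -s] := by
        rw [hPval]
        ext i j
        fin_cases i <;> fin_cases j <;>
          simp [Matrix.mul_apply, Fin.sum_univ_two, h00₀, h11₀, Matrix.diagonal, hs']
      rcases hshape (f h) with hdg | had
      · have e : (P⁻¹ * Matrix.GeneralLinearGroup.map (padicAlgClIntegers p).subtype (ρ₀ (f h)) *
            P).val = ((ρ₀ (f h)).val 0 0 : PadicAlgCl p) •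
              (1 : Matrix (Fin 2) (Fin 2) (PadicAlgCl p)) := by
          rw [Units.val_mul, Units.val_mul, hscalar h hdg, Matrix.mul_smul, Matrix.mul_one,
            Matrix.smul_mul, ← Units.val_mul, inv_mul_cancel, Units.val_one]
        exact ⟨by rw [e]; simp, by rw [e]; simp⟩
      · have e : (P⁻¹ * Matrix.GeneralLinearGroup.map (padicAlgClIntegers p).subtype (ρ₀ (f h)) *
            P).val = ((ρ₀ (f (h * h₀⁻¹))).val 0 0 : PadicAlgCl p) • Matrix.diagonal ![s, -s] := by
          rw [Units.val_mul, Units.val_mul, hprop h had, Matrix.mul_smul, Matrix.smul_mul,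
            Matrix.mul_assoc, hkey, ← Matrix.mul_assoc, ← Units.val_mul, inv_mul_cancel,
            Units.val_one, Matrix.one_mul]
        exact ⟨by rw [e]; simp [Matrix.diagonal], by rw [e]; simp [Matrix.diagonal]⟩
  /- (3) The diagonal characters in the frame `P`, their order and integrality. -/
  set σ : H →* GL (Fin 2) (PadicAlgCl p) :=
    conjGL P⁻¹ (((Matrix.GeneralLinearGroup.map (padicAlgClIntegers p).subtype).comp ρ₀).comp f)
    with hσdef
  have hσ : ∀ h, σ h =
      P⁻¹ * Matrix.GeneralLinearGroup.map (padicAlgClIntegers p).subtype (ρ₀ (f h)) * P := by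
    intro h
    rw [hσdef, conjGL_apply, inv_inv]
    rfl
  have hσDg : ∀ h, GL2.IsDg (σ h).val := fun h => by
    rw [hσ]
    exact hP h
  have hσpow : ∀ h, σ h ^ (2 * n) = 1 := fun h => by
    rw [← map_pow, hσ, map_pow, map_pow, map_pow, hpow, mul_one, inv_mul_cancel]
  obtain ⟨χ, hχ⟩ := exists_characters_of_apply_one_zero_eq_zero (U := σ) fun h => (hσDg h).2
  have hχpow : ∀ h, ((χ h).1 : PadicAlgCl p) ^ (2 * n) = 1 ∧
      ((χ h).2 : PadicAlgCl p) ^ (2 * n) = 1 := by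
    intro h
    obtain ⟨h1, h2⟩ := pow_eq_one_of_isDg hσpow (hσDg h)
    exact ⟨by rw [(hχ h).1]; exact h1, by rw [(hχ h).2]; exact h2⟩
  have h2n : 2 * n ≠ 0 := by omega
  let χ₁ : H →* padicAlgClIntegers p :=
    { toFun := fun h =>
        ⟨((χ h).1 : PadicAlgCl p), mem_padicAlgClIntegers_of_pow_eq_one h2n (hχpow h).1⟩
      map_one' := Subtype.ext (by simp)
      map_mul' := fun a b => Subtype.ext (by simp) }
  let χ₂ : H →* padicAlgClIntegers p :=
    { toFun := fun h =>
        ⟨((χ h).2 : PadicAlgCl p), mem_padicAlgClIntegers_of_pow_eq_one h2n (hχpow h).2⟩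
      map_one' := Subtype.ext (by simp)
      map_mul' := fun a b => Subtype.ext (by simp) }
  have hχ₁ : ∀ h, (χ₁ h : PadicAlgCl p) = (χ h).1 := fun h => rfl
  have hχ₂ : ∀ h, (χ₂ h : PadicAlgCl p) = (χ h).2 := fun h => rfl
  have hσval : ∀ h, (σ h).val = Matrix.diagonal ![(χ₁ h : PadicAlgCl p), (χ₂ h : PadicAlgCl p)] := by
    intro h
    have h00 : (σ h).val 0 0 = (χ₁ h : PadicAlgCl p) := by rw [hχ₁, (hχ h).1]
    have h11 : (σ h).val 1 1 = (χ₂ h : PadicAlgCl p) := by rw [hχ₂, (hχ h).2]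
    ext i j
    fin_cases i <;> fin_cases j <;> simp [Matrix.diagonal, (hσDg h).1, (hσDg h).2, h00, h11]
  /- (4) Characteristic polynomials: over `ℤ̄_p`, over `ℚ̄_p`, and modulo `𝔪`. -/
  have hcharO : ∀ h, ((ρ₀ (f h)).val).charpoly = (X - C (χ₁ h)) * (X - C (χ₂ h)) := by
    intro h
    apply Polynomial.map_injective (padicAlgClIntegers p).subtype
      (padicAlgClIntegers p).subtype_injective
    have e1 : ((ρ₀ (f h)).val).map (padicAlgClIntegers p).subtype =
        (Matrix.GeneralLinearGroup.map (padicAlgClIntegers p).subtype (ρ₀ (f h))).val := rfl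
    have e2 : Matrix.GeneralLinearGroup.map (padicAlgClIntegers p).subtype (ρ₀ (f h)) =
        P * σ h * P⁻¹ := by
      rw [hσ]
      group
    rw [← Matrix.charpoly_map, e1, e2, Units.val_mul, Units.val_mul, Matrix.coe_units_inv,
      Matrix.charpoly_units_conj, hσval, Matrix.charpoly_diagonal, Fin.prod_univ_two,
      Polynomial.map_mul, Polynomial.map_sub, Polynomial.map_sub, Polynomial.map_X,
      Polynomial.map_C, Polynomial.map_C, ValuationSubring.subtype_apply,
      ValuationSubring.subtype_apply]
    simp
  have hchark : ∀ h, ((integralReduction (RingHom.id _) ρ₀ (f h)).val).charpoly =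
      (X - C (residue (padicAlgClIntegers p) (χ₁ h))) *
        (X - C (residue (padicAlgClIntegers p) (χ₂ h))) := by
    intro h
    have e1 : (integralReduction (RingHom.id _) ρ₀ (f h)).val =
        ((ρ₀ (f h)).val).map (residue (padicAlgClIntegers p)) := by
      ext i j
      rw [hred, Matrix.map_apply]
    rw [e1, Matrix.charpoly_map, hcharO, Polynomial.map_mul, Polynomial.map_sub,
      Polynomial.map_sub, Polynomial.map_X, Polynomial.map_C, Polynomial.map_C]
  have hcharT : ∀ h, ((conjGL Q ((integralReduction (RingHom.id _) ρ₀).comp f) h).val).charpoly =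
      (X - C ((conjGL Q ((integralReduction (RingHom.id _) ρ₀).comp f) h).val 0 0)) *
        (X - C ((conjGL Q ((integralReduction (RingHom.id _) ρ₀).comp f) h).val 1 1)) := by
    intro h
    rw [Matrix.charpoly_fin_two, Matrix.trace_fin_two, Matrix.det_fin_two, hQ h, mul_zero,
      sub_zero, map_add, map_mul]
    ring
  have hcharT' : ∀ h,
      ((conjGL Q ((integralReduction (RingHom.id _) ρ₀).comp f) h).val).charpoly =
        ((integralReduction (RingHom.id _) ρ₀ (f h)).val).charpoly := by
    intro h
    rw [conjGL_apply, Units.val_mul, Units.val_mul, Matrix.coe_units_inv,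
      Matrix.charpoly_units_conj]
    rfl
  /- (5) Matching the residual diagonal characters, first pointwise, then globally. -/
  have hmatch : ∀ h,
      ((conjGL Q ((integralReduction (RingHom.id _) ρ₀).comp f) h).val 0 0 =
          residue (padicAlgClIntegers p) (χ₁ h) ∧
        (conjGL Q ((integralReduction (RingHom.id _) ρ₀).comp f) h).val 1 1 =
          residue (padicAlgClIntegers p) (χ₂ h)) ∨
      ((conjGL Q ((integralReduction (RingHom.id _) ρ₀).comp f) h).val 0 0 =
          residue (padicAlgClIntegers p) (χ₂ h) ∧
        (conjGL Q ((integralReduction (RingHom.id _) ρ₀).comp f) h).val 1 1 =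
          residue (padicAlgClIntegers p) (χ₁ h)) := by
    intro h
    apply eq_and_eq_or_eq_and_eq_of_mul_X_sub_C_eq
    rw [← hcharT, hcharT', hchark]
  obtain ⟨ψ, hψ⟩ := exists_characters_of_apply_one_zero_eq_zero hQ
  have hglob := forall_eq_or_forall_eq_of_forall_apply_eq_or
    ((Units.coeHom (padicAlgClResidueField p)).comp ((MonoidHom.fst _ _).comp ψ))
    ((residue (padicAlgClIntegers p)).toMonoidHom.comp χ₁)
    ((residue (padicAlgClIntegers p)).toMonoidHom.comp χ₂) (fun h => by
      change ((ψ h).1 : padicAlgClResidueField p) = residue (padicAlgClIntegers p) (χ₁ h) ∨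
        ((ψ h).1 : padicAlgClResidueField p) = residue (padicAlgClIntegers p) (χ₂ h)
      rw [(hψ h).1]
      rcases hmatch h with ⟨h1, -⟩ | ⟨h1, -⟩
      · exact Or.inl h1
      · exact Or.inr h1)
  have hglob' :
      (∀ h, (conjGL Q ((integralReduction (RingHom.id _) ρ₀).comp f) h).val 0 0 =
          residue (padicAlgClIntegers p) (χ₁ h) ∧
        (conjGL Q ((integralReduction (RingHom.id _) ρ₀).comp f) h).val 1 1 =
          residue (padicAlgClIntegers p) (χ₂ h)) ∨
      (∀ h, (conjGL Q ((integralReduction (RingHom.id _) ρ₀).comp f) h).val 0 0 =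
          residue (padicAlgClIntegers p) (χ₂ h) ∧
        (conjGL Q ((integralReduction (RingHom.id _) ρ₀).comp f) h).val 1 1 =
          residue (padicAlgClIntegers p) (χ₁ h)) := by
    rcases hglob with hg | hg
    · left
      intro h
      have ha : (conjGL Q ((integralReduction (RingHom.id _) ρ₀).comp f) h).val 0 0 =
          residue (padicAlgClIntegers p) (χ₁ h) := by
        rw [← (hψ h).1]
        exact hg h
      refine ⟨ha, ?_⟩
      rcases hmatch h with ⟨-, h2⟩ | ⟨h1, h2⟩
      · exact h2
      · rw [h2, ← ha]
        exact h1
    · right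
      intro h
      have ha : (conjGL Q ((integralReduction (RingHom.id _) ρ₀).comp f) h).val 0 0 =
          residue (padicAlgClIntegers p) (χ₂ h) := by
        rw [← (hψ h).1]
        exact hg h
      refine ⟨ha, ?_⟩
      rcases hmatch h with ⟨h1, h2⟩ | ⟨-, h2⟩
      · rw [h2, ← ha]
        exact h1
      · exact h2
  /- (6) Conclusion, swapping the frame if necessary. -/
  rcases hglob' with hg | hg
  · refine ⟨P, χ₁, χ₂, fun h => ?_, fun h => hχpow h, fun h => ⟨(hg h).1.symm, (hg h).2.symm⟩⟩
    rw [← hσ]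
    exact hσval h
  · let W : GL (Fin 2) (PadicAlgCl p) :=
      Matrix.GeneralLinearGroup.mkOfDetNeZero !![(0 : PadicAlgCl p), 1; 1, 0]
        (by rw [Matrix.det_fin_two_of]; simp)
    have hW : W.val = !![(0 : PadicAlgCl p), 1; 1, 0] := rfl
    have hWW : W * W = 1 := Units.ext (by
      rw [Units.val_mul, hW, Units.val_one]
      ext i j
      fin_cases i <;> fin_cases j <;> simp [Matrix.mul_apply, Fin.sum_univ_two])
    have hWinv : W⁻¹ = W := inv_eq_of_mul_eq_one_right hWW
    have hW00 : W.val 0 0 = 0 := rfl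
    have hW01 : W.val 0 1 = 1 := rfl
    have hW10 : W.val 1 0 = 1 := rfl
    have hW11 : W.val 1 1 = 0 := rfl
    refine ⟨P * W, χ₂, χ₁, fun h => ?_, fun h => ⟨(hχpow h).2, (hχpow h).1⟩,
      fun h => ⟨(hg h).1.symm, (hg h).2.symm⟩⟩
    have e : (P * W)⁻¹ * Matrix.GeneralLinearGroup.map (padicAlgClIntegers p).subtype (ρ₀ (f h)) *
        (P * W) =
        W⁻¹ * (P⁻¹ * Matrix.GeneralLinearGroup.map (padicAlgClIntegers p).subtype (ρ₀ (f h)) * P) *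
          W := by
      simp only [_root_.mul_inv_rev, mul_assoc]
    rw [e, ← hσ, hWinv, Units.val_mul, Units.val_mul, hσval h]
    ext i j
    fin_cases i <;> fin_cases j <;>
      simp [Matrix.mul_apply, Fin.sum_univ_two, Matrix.diagonal_apply_eq,
        Matrix.diagonal_apply_ne, hW00, hW01, hW10, hW11]

/-- **The Teichmüller lift of an irreducible representation of dihedral type, with its monomial
shape** — `exists_teichmullerLift_of_isDihedralType` of `TeichmullerLiftMonomial` with one more
conjunct exported: every reduction `ρ₁(g) mod 𝔪` is diagonal or antidiagonal (the frame being
the one in which `ρ̄` is monomial), the hypothesis of `exists_conjGL_diagonal_comp_of_monomial`.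
[cite: Allen2014, Lemma 87 (arXiv:1301.1113, §5.1.1, p. 70)] -/
theorem exists_teichmullerLift_of_isDihedralType_shape
    (τ : G →* GL (Fin 2) (padicAlgClResidueField p))
    [Finite τ.range] (hce : ¬ HasCommonEigenvector τ) (hτ : IsDihedralType τ) :
    ∃ (ρ₁ : G →* GL (Fin 2) (padicAlgClIntegers p)) (Q : GL (Fin 2) (padicAlgClResidueField p))
      (n : ℕ), 0 < n ∧ ¬ p ∣ n ∧ ρ₁.ker = τ.ker ∧
      (∀ g, τ g = Q * integralReduction (RingHom.id _) ρ₁ g * Q⁻¹) ∧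
      (∀ g i j, (ρ₁ g).val i j = 0 ∨ ((ρ₁ g).val i j : PadicAlgCl p) ^ n = 1) ∧
      ∀ g, GL2.IsDg (integralReduction (RingHom.id _) ρ₁ g).val ∨
        GL2.IsAd (integralReduction (RingHom.id _) ρ₁ g).val := by
  haveI : IsAlgClosed (padicAlgClResidueField p) :=
    Literature.RingTheory.Valuation.isAlgClosed_residueField (padicAlgClIntegers p)
  obtain ⟨H, P, -, hDg, hAd, -⟩ :=
    exists_monomial_of_isDihedralType_of_not_hasCommonEigenvector τ hce hτ
  have hshape : ∀ g, GL2.IsDg ((conjGL P τ g : GL (Fin 2) _) :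
      Matrix (Fin 2) (Fin 2) (padicAlgClResidueField p)) ∨
      GL2.IsAd ((conjGL P τ g : GL (Fin 2) _) :
        Matrix (Fin 2) (Fin 2) (padicAlgClResidueField p)) := fun g => by
    by_cases hg : g ∈ H
    · exact Or.inl (hDg g hg)
    · exact Or.inr (hAd g hg)
  have hfin : ∃ N : ℕ, 0 < N ∧ ∀ g, conjGL P τ g ^ N = 1 := by
    haveI : Nonempty τ.range := ⟨1⟩
    refine ⟨Nat.card τ.range, Nat.card_pos, fun g => ?_⟩
    have h1 : (⟨τ g, g, rfl⟩ : τ.range) ^ Nat.card τ.range = 1 := pow_card_eq_one'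
    have h2 : τ g ^ Nat.card τ.range = 1 := by
      have := congrArg Subtype.val h1
      simpa using this
    rw [← map_pow, conjGL_apply, map_pow, h2, mul_one, mul_inv_cancel]
  obtain ⟨D, n, hn0, hn, hmono⟩ := exists_conjGL_monomial_pow_eq_one (conjGL P τ) hshape hfin
  have e : conjGL D (conjGL P τ) = conjGL (D * P) τ := MonoidHom.ext fun g => by
    simp only [conjGL_apply, _root_.mul_inv_rev]
    group
  rw [e] at hmono
  obtain ⟨ρ₁, hred, hker, hroots⟩ :=
    exists_monoidHom_integralReduction_eq_of_monomial hn0 hn (conjGL (D * P) τ) hmono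
  refine ⟨ρ₁, (D * P)⁻¹, n, hn0, hn, by rw [hker, ker_conjGL], fun g => ?_, hroots, fun g => ?_⟩
  · rw [hred, conjGL_apply, inv_inv]
    group
  · rw [hred]
    rcases hmono g with ⟨h01, h10, -, -⟩ | ⟨h00, h11, -, -⟩
    · exact Or.inl ⟨h01, h10⟩
    · exact Or.inr ⟨h00, h11⟩

end LocalShape

/-! ### The Galois case: the Artin lift is a sum of two characters on decomposition groups -/

section Galois

open Field

/-- A group homomorphism out of a topological group with open kernel is continuous (private
copy of the helper of `TeichmullerLiftMonomial`). [folklore] -/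
private theorem continuous_of_isOpen_ker_aux' {G H : Type*} [Group G] [TopologicalSpace G]
    [IsTopologicalGroup G] [Group H] [TopologicalSpace H] [ContinuousMul H] (f : G →* H)
    (hf : IsOpen (f.ker : Set G)) : Continuous f := by
  apply continuous_of_continuousAt_one f
  rw [ContinuousAt, map_one]
  intro U hU
  rw [Filter.mem_map]
  apply Filter.mem_of_superset (hf.mem_nhds (by simp))
  intro g hg
  rw [SetLike.mem_coe, MonoidHom.mem_ker] at hg
  rw [Set.mem_preimage, hg]
  exact mem_of_mem_nhds hU

variable {K : Type*} [Field K] [NumberField K]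

/-- **The Artin lift `ρ₁ = Ind χ` of a residual representation of dihedral type is a sum of two
finite-order characters on every decomposition group where `ρ̄` is reducible** (Allen 2014,
Lemma 87: "`ρ₁|_{G_v} ≅ (χ'_v 0 ; 0 χ_v)`", with `ρ̄|_{G_v} ≅ (χ̄'_v ∗ ; 0 χ̄_v)` and `χ_v`
lifting `χ̄_v`).  For `ρ : Γ_K → GL₂(ℚ̄_p)` over a number field with a residual representation
`τ` of irreducible dihedral type: the continuous Artin lift `ρ₁` of `τ`
(`FramedGaloisRep.exists_artinLift_of_isDihedralType`, values in `GL₂(ℤ̄_p)`, open kernel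
`= ker τ`, root-of-unity entries, `τ` a reduction of `ρ₁`) has, at every finite place `v` and for
every triangular form `Q (τ|_{Γ_{K_v}}) Q⁻¹ = (ā ∗ ; 0 b̄)`, a frame `P ∈ GL₂(ℚ̄_p)` with
`P⁻¹ ρ₁|_{Γ_{K_v}} P = diag(χ₁, χ₂)`, `χ₁, χ₂ : Γ_{K_v} → ℤ̄_p` continuous of order dividing
`2n`, `χ̄₁ = ā`, `χ̄₂ = b̄`.
[cite: Allen2014, Lemma 87 and the preceding paragraph (arXiv:1301.1113, §5.1.1, pp. 69–70)] -/
theorem FramedGaloisRep.exists_artinLift_of_isDihedralType_diagonal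
    {ρ : FramedGaloisRep K (PadicAlgCl p) 2}
    {τ : absoluteGaloisGroup K →* GL (Fin 2) (padicAlgClResidueField p)}
    (hτ : ρ.IsResidualRepOf (RingHom.id _) τ) (hce : ¬ HasCommonEigenvector τ)
    (hdih : IsDihedralType τ) :
    ∃ (ρ₁ : FramedGaloisRep K (PadicAlgCl p) 2)
      (ρ₀ : absoluteGaloisGroup K →* GL (Fin 2) (padicAlgClIntegers p)) (n : ℕ), 0 < n ∧ ¬ p ∣ n ∧
      (∀ σ, Matrix.GeneralLinearGroup.map (padicAlgClIntegers p).subtype (ρ₀ σ) = ρ₁ σ) ∧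
      ρ₀.ker = τ.ker ∧ IsOpen ((ρ₁ : absoluteGaloisGroup K →* GL (Fin 2) (PadicAlgCl p)).ker :
        Set (absoluteGaloisGroup K)) ∧
      ρ₁.IsReductionOf (RingHom.id _) τ ∧
      (∀ σ i j, (ρ₀ σ).val i j = 0 ∨ ((ρ₀ σ).val i j : PadicAlgCl p) ^ n = 1) ∧
      ∀ (v : HeightOneSpectrum (𝓞 K)) (Q : GL (Fin 2) (padicAlgClResidueField p)),
        (∀ σ, (conjGL Q (τ.comp (absGaloisRestrict K (v.adicCompletion K)).toMonoidHom) σ).val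
          1 0 = 0) →
        ∃ (P : GL (Fin 2) (PadicAlgCl p))
          (χ₁ χ₂ : absoluteGaloisGroup (v.adicCompletion K) →* padicAlgClIntegers p),
          (∀ σ, (P⁻¹ * ρ₁.toLocal v σ * P).val =
            Matrix.diagonal ![(χ₁ σ : PadicAlgCl p), (χ₂ σ : PadicAlgCl p)]) ∧
          (∀ σ, (χ₁ σ : PadicAlgCl p) ^ (2 * n) = 1 ∧ (χ₂ σ : PadicAlgCl p) ^ (2 * n) = 1) ∧
          (∀ σ, residue (padicAlgClIntegers p) (χ₁ σ) =
              (conjGL Q (τ.comp (absGaloisRestrict K (v.adicCompletion K)).toMonoidHom) σ).val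
                0 0 ∧
            residue (padicAlgClIntegers p) (χ₂ σ) =
              (conjGL Q (τ.comp (absGaloisRestrict K (v.adicCompletion K)).toMonoidHom) σ).val
                1 1) ∧
          Continuous (fun σ => (χ₁ σ : PadicAlgCl p)) ∧
          Continuous (fun σ => (χ₂ σ : PadicAlgCl p)) := by
  haveI : Finite τ.range := FramedGaloisRep.finite_range_of_isResidualRepOf hτ
  obtain ⟨ρ₀, Q₀, n, hn0, hn, hker, hQ₀, hroots, hshape⟩ :=
    exists_teichmullerLift_of_isDihedralType_shape τ hce hdih
  -- the `ℚ̄_p`-valued Artin representation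
  let f : absoluteGaloisGroup K →* GL (Fin 2) (PadicAlgCl p) :=
    (Matrix.GeneralLinearGroup.map (padicAlgClIntegers p).subtype).comp ρ₀
  have hfker : f.ker = τ.ker := by
    rw [← hker]
    ext σ
    rw [MonoidHom.mem_ker, MonoidHom.mem_ker, MonoidHom.comp_apply]
    constructor
    · intro h
      have hinj : Function.Injective
          (Matrix.GeneralLinearGroup.map (n := Fin 2) (padicAlgClIntegers p).subtype) := by
        intro A B hAB
        refine Units.ext (Matrix.ext fun i j => (padicAlgClIntegers p).subtype_injective ?_)
        have := congrArg (fun M : GL (Fin 2) (PadicAlgCl p) =>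
          (M : Matrix (Fin 2) (Fin 2) (PadicAlgCl p)) i j) hAB
        simpa [Matrix.GeneralLinearGroup.map_apply] using this
      exact hinj (h.trans (map_one _).symm)
    · intro h
      rw [h, map_one]
  have hopen : IsOpen (f.ker : Set (absoluteGaloisGroup K)) := by
    rw [hfker]
    exact FramedGaloisRep.isOpen_ker_of_isResidualRepOf hτ
  let ρ₁ : FramedGaloisRep K (PadicAlgCl p) 2 := ⟨f, continuous_of_isOpen_ker_aux' f hopen⟩
  refine ⟨ρ₁, ρ₀, n, hn0, hn, fun σ => rfl, hker, hopen,
    ⟨ρ₀, Q₀, ⟨1, fun σ => by rw [inv_one, one_mul, mul_one]; rfl⟩, hQ₀⟩, hroots, ?_⟩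
  intro v Q hQ
  -- the given triangular form of `τ|_{Γ_{K_v}}` is a triangular form of `(ρ₀ mod 𝔪)|_{Γ_{K_v}}`
  have hconj : ∀ σ,
      conjGL (Q * Q₀) ((integralReduction (RingHom.id _) ρ₀).comp
        (absGaloisRestrict K (v.adicCompletion K)).toMonoidHom) σ =
      conjGL Q (τ.comp (absGaloisRestrict K (v.adicCompletion K)).toMonoidHom) σ := by
    intro σ
    rw [conjGL_apply, conjGL_apply, MonoidHom.comp_apply, MonoidHom.comp_apply, hQ₀]
    group
  have hQ' : ∀ σ, (conjGL (Q * Q₀) ((integralReduction (RingHom.id _) ρ₀).comp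
      (absGaloisRestrict K (v.adicCompletion K)).toMonoidHom) σ).val 1 0 = 0 := fun σ => by
    rw [hconj σ]
    exact hQ σ
  obtain ⟨P, χ₁, χ₂, hdiag, hpow, hres⟩ := exists_conjGL_diagonal_comp_of_monomial hn0 hn ρ₀
    hroots hshape (absGaloisRestrict K (v.adicCompletion K)).toMonoidHom (Q * Q₀) hQ'
  have hdiag' : ∀ σ, (P⁻¹ * ρ₁.toLocal v σ * P).val =
      Matrix.diagonal ![(χ₁ σ : PadicAlgCl p), (χ₂ σ : PadicAlgCl p)] := fun σ => hdiag σ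
  -- continuity of the diagonal entries of the continuous `P⁻¹ ρ₁|_{Γ_{K_v}} P`
  have hcont : Continuous fun σ => (P⁻¹ * ρ₁.toLocal v σ * P).val :=
    Units.continuous_val.comp
      ((continuous_const.mul (map_continuous (ρ₁.toLocal v))).mul continuous_const)
  refine ⟨P, χ₁, χ₂, hdiag', hpow, fun σ => ?_, ?_, ?_⟩
  · rw [← hconj σ]
    exact hres σ
  · refine (hcont.matrix_elem 0 0).congr fun σ => ?_
    rw [hdiag' σ]
    simp [Matrix.diagonal]
  · refine (hcont.matrix_elem 1 1).congr fun σ => ?_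
    rw [hdiag' σ]
    simp [Matrix.diagonal]

/-- **Allen 2014, Lemma 87 at `p = 2`, the Galois side from hypothesis (4) of the Introduction
Theorem: the Artin lift of `ρ̄` and its local shape.**  For `ρ : Γ_K → GL₂(ℚ̄₂)` residually
absolutely irreducible with solvable residual image (so `ρ̄ = ρ.residualRep` is of irreducible
dihedral type, `FramedGaloisRep.isDihedralType_residualRep_of_isSolvable_two`): a continuous Artin
lift `ρ₁` of `ρ̄` with integral model `ρ₀`, `ker ρ₀ = ker ρ̄` open, root-of-unity entries of odd
order, odd as soon as `ρ̄(c) ≠ 1` for all complex conjugations, AND at every finite place `v`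
where `ρ̄|_{Γ_{K_v}}` has a triangular form `(χ̄'_v ∗ ; 0 χ̄_v)`:
`ρ₁|_{Γ_{K_v}} ≅ χ'_v ⊕ χ_v` with `χ'_v, χ_v : Γ_{K_v} → ℤ̄₂` continuous of finite order lifting
`χ̄'_v, χ̄_v` ("we have `ρ₁|_{G_v} ≅ (χ'_v 0 ; 0 χ_v)`", p. 70).
[cite: Allen2014, Lemma 87 and the preceding paragraph (arXiv:1301.1113, §5.1.1, pp. 69–70)] -/
theorem FramedGaloisRep.exists_artinLift_residualRep_diagonal_of_isSolvable_two
    (ρ : FramedGaloisRep K (PadicAlgCl 2) 2) (hres : ρ.IsResiduallyAbsIrreducible)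
    (hsol : IsSolvable ρ.residualRep.range) :
    ∃ (ρ₁ : FramedGaloisRep K (PadicAlgCl 2) 2)
      (ρ₀ : absoluteGaloisGroup K →* GL (Fin 2) (padicAlgClIntegers 2)) (n : ℕ), 0 < n ∧ ¬ 2 ∣ n ∧
      (∀ σ, Matrix.GeneralLinearGroup.map (padicAlgClIntegers 2).subtype (ρ₀ σ) = ρ₁ σ) ∧
      ρ₀.ker = ρ.residualRep.ker ∧
      IsOpen ((ρ₁ : absoluteGaloisGroup K →* GL (Fin 2) (PadicAlgCl 2)).ker :
        Set (absoluteGaloisGroup K)) ∧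
      ρ₁.IsReductionOf (RingHom.id _) ρ.residualRep ∧
      (∀ σ i j, (ρ₀ σ).val i j = 0 ∨ ((ρ₀ σ).val i j : PadicAlgCl 2) ^ n = 1) ∧
      ((∀ (φ : K →+* ℝ) (c : absoluteGaloisGroup K), IsComplexConjugation φ c →
          ρ.residualRep c ≠ 1) → ρ₁.IsOdd) ∧
      ∀ (v : HeightOneSpectrum (𝓞 K)) (Q : GL (Fin 2) (padicAlgClResidueField 2)),
        (∀ σ, (conjGL Q (ρ.residualRep.comp
          (absGaloisRestrict K (v.adicCompletion K)).toMonoidHom) σ).val 1 0 = 0) →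
        ∃ (P : GL (Fin 2) (PadicAlgCl 2))
          (χ₁ χ₂ : absoluteGaloisGroup (v.adicCompletion K) →* padicAlgClIntegers 2),
          (∀ σ, (P⁻¹ * ρ₁.toLocal v σ * P).val =
            Matrix.diagonal ![(χ₁ σ : PadicAlgCl 2), (χ₂ σ : PadicAlgCl 2)]) ∧
          (∀ σ, (χ₁ σ : PadicAlgCl 2) ^ (2 * n) = 1 ∧ (χ₂ σ : PadicAlgCl 2) ^ (2 * n) = 1) ∧
          (∀ σ, residue (padicAlgClIntegers 2) (χ₁ σ) =
              (conjGL Q (ρ.residualRep.comp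
                (absGaloisRestrict K (v.adicCompletion K)).toMonoidHom) σ).val 0 0 ∧
            residue (padicAlgClIntegers 2) (χ₂ σ) =
              (conjGL Q (ρ.residualRep.comp
                (absGaloisRestrict K (v.adicCompletion K)).toMonoidHom) σ).val 1 1) ∧
          Continuous (fun σ => (χ₁ σ : PadicAlgCl 2)) ∧
          Continuous (fun σ => (χ₂ σ : PadicAlgCl 2)) := by
  obtain ⟨hspec, _, hce, hdih⟩ := ρ.isDihedralType_residualRep_of_isSolvable_two hres hsol
  obtain ⟨ρ₁, ρ₀, n, hn0, hn, hmap, hker, hopen, hred, hroots, hloc⟩ :=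
    FramedGaloisRep.exists_artinLift_of_isDihedralType_diagonal hspec hce hdih
  exact ⟨ρ₁, ρ₀, n, hn0, hn, hmap, hker, hopen, hred, hroots,
    fun hc => ρ₁.isOdd_of_isReductionOf_ne_one_two hred hc, hloc⟩

/-- **Allen 2014, Lemma 87 at `p = 2`, from hypotheses (2) and (4) of the Introduction Theorem**
("for each `v ∣ p`, `ρ̄|_{G_v}` is reducible.  Write `ρ̄|_{G_v} ≅ (χ̄'_v ∗ ; 0 χ̄_v)` … we have
`ρ₁|_{G_v} ≅ (χ'_v 0 ; 0 χ_v)`", pp. 69–70): for `ρ : Γ_K → GL₂(ℚ̄₂)` residually absolutely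
irreducible with solvable residual image, the Artin lift `ρ₁` of `ρ̄ = ρ.residualRep` of
`FramedGaloisRep.exists_artinLift_residualRep_diagonal_of_isSolvable_two` satisfies, at every
finite place `v` where `ρ` is ordinary of some weight (hypothesis (2): then `ρ̄|_{Γ_{K_v}}` is
reducible, `FramedGaloisRep.IsOrdinaryOfWeightAt.hasCommonEigenvector_residualRep_comp`): there
is a triangular form `Q (ρ̄|_{Γ_{K_v}}) Q⁻¹ = (χ̄'_v ∗ ; 0 χ̄_v)` and
`ρ₁|_{Γ_{K_v}} ≅ χ'_v ⊕ χ_v` with `χ'_v, χ_v : Γ_{K_v} → ℤ̄₂` continuous of finite order,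
`χ'_v ≡ χ̄'_v`, `χ_v ≡ χ̄_v (mod 𝔪)`.
[cite: Allen2014, Lemma 87 and the preceding paragraph (arXiv:1301.1113, §5.1.1, pp. 69–70)] -/
theorem FramedGaloisRep.exists_artinLift_residualRep_diagonal_of_isOrdinaryOfWeightAt_two
    (ρ : FramedGaloisRep K (PadicAlgCl 2) 2) (hres : ρ.IsResiduallyAbsIrreducible)
    (hsol : IsSolvable ρ.residualRep.range) :
    ∃ (ρ₁ : FramedGaloisRep K (PadicAlgCl 2) 2)
      (ρ₀ : absoluteGaloisGroup K →* GL (Fin 2) (padicAlgClIntegers 2)) (n : ℕ), 0 < n ∧ ¬ 2 ∣ n ∧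
      (∀ σ, Matrix.GeneralLinearGroup.map (padicAlgClIntegers 2).subtype (ρ₀ σ) = ρ₁ σ) ∧
      ρ₀.ker = ρ.residualRep.ker ∧
      IsOpen ((ρ₁ : absoluteGaloisGroup K →* GL (Fin 2) (PadicAlgCl 2)).ker :
        Set (absoluteGaloisGroup K)) ∧
      ρ₁.IsReductionOf (RingHom.id _) ρ.residualRep ∧
      (∀ σ i j, (ρ₀ σ).val i j = 0 ∨ ((ρ₀ σ).val i j : PadicAlgCl 2) ^ n = 1) ∧
      ((∀ (φ : K →+* ℝ) (c : absoluteGaloisGroup K), IsComplexConjugation φ c →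
          ρ.residualRep c ≠ 1) → ρ₁.IsOdd) ∧
      ∀ (v : HeightOneSpectrum (𝓞 K)) (k m : ℕ), FramedGaloisRep.IsOrdinaryOfWeightAt 2 ρ v k m →
        ∃ (Q : GL (Fin 2) (padicAlgClResidueField 2)) (P : GL (Fin 2) (PadicAlgCl 2))
          (χ₁ χ₂ : absoluteGaloisGroup (v.adicCompletion K) →* padicAlgClIntegers 2),
          (∀ σ, (conjGL Q (ρ.residualRep.comp
            (absGaloisRestrict K (v.adicCompletion K)).toMonoidHom) σ).val 1 0 = 0) ∧
          (∀ σ, (P⁻¹ * ρ₁.toLocal v σ * P).val =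
            Matrix.diagonal ![(χ₁ σ : PadicAlgCl 2), (χ₂ σ : PadicAlgCl 2)]) ∧
          (∀ σ, (χ₁ σ : PadicAlgCl 2) ^ (2 * n) = 1 ∧ (χ₂ σ : PadicAlgCl 2) ^ (2 * n) = 1) ∧
          (∀ σ, residue (padicAlgClIntegers 2) (χ₁ σ) =
              (conjGL Q (ρ.residualRep.comp
                (absGaloisRestrict K (v.adicCompletion K)).toMonoidHom) σ).val 0 0 ∧
            residue (padicAlgClIntegers 2) (χ₂ σ) =
              (conjGL Q (ρ.residualRep.comp
                (absGaloisRestrict K (v.adicCompletion K)).toMonoidHom) σ).val 1 1) ∧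
          Continuous (fun σ => (χ₁ σ : PadicAlgCl 2)) ∧
          Continuous (fun σ => (χ₂ σ : PadicAlgCl 2)) := by
  obtain ⟨ρ₁, ρ₀, n, hn0, hn, hmap, hker, hopen, hred, hroots, hodd, hloc⟩ :=
    ρ.exists_artinLift_residualRep_diagonal_of_isSolvable_two hres hsol
  refine ⟨ρ₁, ρ₀, n, hn0, hn, hmap, hker, hopen, hred, hroots, hodd, fun v k m hord => ?_⟩
  obtain ⟨R, hR⟩ := hord.hasCommonEigenvector_residualRep_comp.exists_conjGL_apply_one_zero_eq_zero
  obtain ⟨P, χ₁, χ₂, h1, h2, h3, h4, h5⟩ := hloc v R⁻¹ hR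
  exact ⟨R⁻¹, P, χ₁, χ₂, hR, h1, h2, h3, h4, h5⟩

end Galois

end Literature.NumberTheory.GaloisRepresentations

end
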